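import Summits.BirchSwinnertonDyer.BirchSwinnertonDyer.Theses.ShadowIsolation
import Summits.BirchSwinnertonDyer.BirchSwinnertonDyer.Theses.SelmerRank
import Summits.BirchSwinnertonDyer.BirchSwinnertonDyer.Theorems.ShadowIsolationShaUnboundedOfCorank
import Summits.BirchSwinnertonDyer.BirchSwinnertonDyer.Theorems.SelmerRankShaCorank
import Literature.NumberTheory.EllipticCurves.NonEisensteinPrimeOfSurjective
import HarnessLib

/-!
# BirchSwinnertonDyer / ShadowIsolation + SelmerRank — crux `SelmerRankUB`
# (stmt-BirchSwinnertonDyer-0130), line `greenberg-split`, stub `stub_shaCotorsionBigImage`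

The crux is the upper half of `p^∞`-Selmer BSD at a big-image good ordinary prime `p ≥ 5`
(`corank_{ℤ_p} Sel_{p^∞}(E/ℚ) ≤ ord_{s=1} L(E,s)`). Line `greenberg-split` cuts it by Greenberg's
PROVED identity `corank Sel_{p^∞} = rank E(ℚ) + corank Ш(E/ℚ)[p^∞]`
(`WeierstrassCurve.selmerCorank_eq_mordellWeilRank_add_holds`). The registered stub
`stub_shaCotorsionBigImage` is the Ш-half:

  for `W/ℚ` globally minimal elliptic, `p ≥ 5` good ordinary with `ρ̄_{E,p}` surjective and
  `ord_{s=1} L(E,s) ≥ 2`, `shaCorank W p = 0` (no divisible part in `Ш(E/ℚ)[p^∞]`).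

Unconditionally this is the Ш-cotorsion (Ш-finiteness in corank form) conjecture — OPEN. What this
file lands are its two **in-route discharges** from registered route items, each concluding the
stub's EXACT statement:

* `shaCotorsionBigImage_of_isolation_of_shadow` — on route ShadowIsolation from its cruxes
  `IsolationOfAccidentalZeros` (stmt-BirchSwinnertonDyer-15786) and `PhantomShadow`
  (stmt-BirchSwinnertonDyer-15787): contrapositive — a non-zero Ш-corank gives Ш-elements of every
  exact order `p^n` (landed `Theorems.shaUnboundedOfCorank_proof`), `PhantomShadow` turns one of
  exact order `p^n`, `n ≥ 1`, into an accidental even-sign zero at depth `n`, contradicting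
  `IsolationOfAccidentalZeros` beyond its `n₀`; those cruxes are stated for IRREDUCIBLE `E[p]`, and
  surjective ⇒ irreducible is the tree theorem
  `Literature.NumberTheory.EllipticCurves.hasIrreducibleModPGaloisRep_of_hasSurjectiveModNGaloisRep`.
* `shaCotorsionBigImage_of_shaPFinite` — on route SelmerRank from its crux `SelmerRankShaPFinite`
  (stmt-BirchSwinnertonDyer-0132): a finite `Ш[p^∞]` has `ℤ_p`-corank `0`
  (`Literature.BSD.shaCorank_eq_zero_of_finite`).

Both discharges are registered as (conditional) sub-goals of stmt-BirchSwinnertonDyer-0130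
(`ledger workitem stub-add`, same names and signatures) so that this `--supports` helper file passes
`supports.stub-mismatch`; they do NOT close the stub, which stays the open Ш-half of the line.
-/

set_option linter.dupNamespace false

namespace Summit.BirchSwinnertonDyer.BirchSwinnertonDyer.Theorems

open Summit.BirchSwinnertonDyer.BirchSwinnertonDyer.Theses

/-- **Surjective ⇒ irreducible** at a prime `p` for an elliptic `W/ℚ`: a surjective
`ρ̄_{E,p} : Γ_ℚ → GL₂(𝔽_p)` leaves no proper non-zero stable subgroup of `E[p]` (Serre 1972 §4;
tree theorem `hasIrreducibleModPGaloisRep_of_hasSurjectiveModNGaloisRep`, here with the instance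
`NeZero (p : ℚ)` supplied from `p.Prime`). [folklore] -/
theorem shaCotorsionBigImage_irreducible_of_surjective (W : WeierstrassCurve ℚ) [W.IsElliptic]
    (p : ℕ) [Fact p.Prime] (h : W.HasSurjectiveModNGaloisRep p) :
    W.HasIrreducibleModPGaloisRep p := by
  haveI : NeZero (p : ℚ) := ⟨by exact_mod_cast (Fact.out : p.Prime).ne_zero⟩
  exact Literature.NumberTheory.EllipticCurves.hasIrreducibleModPGaloisRep_of_hasSurjectiveModNGaloisRep
    W p h

/-- **Ш-cotorsion at an irreducible good ordinary prime from Isolation ∧ Shadow** (the first half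
of route ShadowIsolation's glue `CruxesToTarget`): for `W/ℚ` globally minimal elliptic and `p ≥ 5`
good ordinary with `E[p]` irreducible, `corank_{ℤ_p} Ш(E/ℚ)[p^∞] = 0`. Contrapositive: a non-zero
corank gives an element of `Ш` of exact order `p ^ max n₀ 1` (`shaUnboundedOfCorank_proof`,
Greenberg 1999 §1), `PhantomShadow` makes it an accidental zero at depth `max n₀ 1 ≥ n₀`, which
`IsolationOfAccidentalZeros` forbids. [cite: GreenbergLNM1716, §1] -/
theorem shaCotorsion_irreducible_of_isolation_of_shadow
    (hIso : ShadowIsolation.IsolationOfAccidentalZeros) (hSh : ShadowIsolation.PhantomShadow) :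
    ∀ (W : WeierstrassCurve ℚ) [W.IsElliptic] [W.IsGloballyMinimal] (p : ℕ) [Fact p.Prime],
      5 ≤ p → W.HasGoodReductionAtPrime p → ¬ (p : ℤ) ∣ W.frobeniusTrace p →
        W.HasIrreducibleModPGaloisRep p → W.shaCorank p = 0 := by
  intro W _ _ p _ h5 hgood hord hirr
  by_contra hne
  obtain ⟨n₀, hn₀⟩ := hIso W p h5 hgood hord hirr
  obtain ⟨σ, hσ⟩ := shaUnboundedOfCorank_proof W p hne (max n₀ 1)
  exact hn₀ (max n₀ 1) (le_max_left _ _)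
    (hSh W p h5 hgood hord hirr (max n₀ 1) (le_max_right _ _) ⟨σ, hσ⟩)

/-- **Stub `stub_shaCotorsionBigImage` discharged on route ShadowIsolation** by its cruxes
`IsolationOfAccidentalZeros` (stmt-BirchSwinnertonDyer-15786) and `PhantomShadow`
(stmt-BirchSwinnertonDyer-15787): for `W/ℚ` globally minimal elliptic, `p ≥ 5` good ordinary with
`ρ̄_{E,p}` surjective and `ord_{s=1} L(E,s) ≥ 2`, `corank_{ℤ_p} Ш(E/ℚ)[p^∞] = 0` — surjective ⇒
irreducible, then `shaCotorsion_irreducible_of_isolation_of_shadow` (the analytic-rank hypothesis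
is not used). [cite: GreenbergLNM1716, §1] -/
theorem shaCotorsionBigImage_of_isolation_of_shadow :
    Summit.BirchSwinnertonDyer.BirchSwinnertonDyer.Theses.ShadowIsolation.IsolationOfAccidentalZeros →
    Summit.BirchSwinnertonDyer.BirchSwinnertonDyer.Theses.ShadowIsolation.PhantomShadow →
    ∀ (W : WeierstrassCurve ℚ) [W.IsElliptic] [W.IsGloballyMinimal] (p : ℕ) [Fact p.Prime],
      5 ≤ p → W.HasGoodReductionAtPrime p → ¬ (p : ℤ) ∣ W.frobeniusTrace p →
        W.HasSurjectiveModNGaloisRep p → 2 ≤ W.analyticRank → W.shaCorank p = 0 :=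
  fun hIso hSh W _ _ p _ h5 hgood hord hsurj _ =>
    shaCotorsion_irreducible_of_isolation_of_shadow hIso hSh W p h5 hgood hord
      (shaCotorsionBigImage_irreducible_of_surjective W p hsurj)

/-- **Stub `stub_shaCotorsionBigImage` discharged on route SelmerRank** by its crux
`SelmerRankShaPFinite` (stmt-BirchSwinnertonDyer-0132, `Ш(E/ℚ)[p^∞]` finite for every elliptic
`W/ℚ` and prime `p`): a finite `p`-primary Ш has `ℤ_p`-corank `0`
(`Literature.BSD.shaCorank_eq_zero_of_finite`, Greenberg 1999 §1); none of the prime / image /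
analytic-rank hypotheses is used. [cite: GreenbergLNM1716, §1] -/
theorem shaCotorsionBigImage_of_shaPFinite :
    Summit.BirchSwinnertonDyer.BirchSwinnertonDyer.Theses.SelmerRank.SelmerRankShaPFinite →
    ∀ (W : WeierstrassCurve ℚ) [W.IsElliptic] [W.IsGloballyMinimal] (p : ℕ) [Fact p.Prime],
      5 ≤ p → W.HasGoodReductionAtPrime p → ¬ (p : ℤ) ∣ W.frobeniusTrace p →
        W.HasSurjectiveModNGaloisRep p → 2 ≤ W.analyticRank → W.shaCorank p = 0 :=
  fun hSha W _ _ p _ _ _ _ _ _ => Literature.BSD.shaCorank_eq_zero_of_finite W p (hSha W p)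

end Summit.BirchSwinnertonDyer.BirchSwinnertonDyer.Theorems
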